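import Mathlib
import Summits.Ventures.PercRepro2.KPrimeRootLeafCycle5
import Summits.Ventures.PercRepro2.KPrimeRootLeafExtA1

/-!
# `(K′)` on every cycle with the root `a₂` on a leaf (blind cell PercRepro2, mine-c g42;
`conjectures/MINE-C.md` §51.4)

For the `n`-cycle with the marks `a₁, z, b, v, y` and the root `a₂` hung on a leaf at `z`, `(K′)`
holds for every admissible weight vector whose leaf weight is `≠ 1` (`kprime_cycle_rootLeaf_a₂`):
by `kprime_leafExt_a₂` the statement reduces to `(K′)` on the cycle at the `z`-instance
(`kprime_cycle`, g41) and to the three root-leaf coefficients `F₀, G₁, G₂` on the cycle; the arc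
reduction (`conn_marks_iff`, `prob_arcOpen_preimage`) carries the mass vectors to `C₅` at the ranks
of the marks (`kmasses_transport'`, `isoMasses_transport'`), the rotation (`kmasses_shift5`,
`isoMasses_shift5`) puts `a₁` at `0`, and the dispatch lemmas of `KPrimeRootLeafCycle5.lean`
supply the certificates.
-/

namespace Summit.Ventures.PercRepro2

namespace KPrimeCycle

open Cycle

section Rotate

variable {R : Type*} [Field R]

/-- **Rotating the isolated mass vector** of the `5`-cycle. -/
theorem isoMasses_shift5 (w : Fin 5 → R) (k a₁ b v y : Fin 5) :
    KPrime.isoMasses (cycN 5) a₁ b v y w =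
      KPrime.isoMasses (cycN 5) (a₁ - k) (b - k) (v - k) (y - k) (w ∘ shiftEquiv k) :=
  isoMasses_transport' (prob_shift5 w k) (fun ω x z => conn_cycN_shift ω k x z) a₁ b v y

end Rotate

section Theorem

variable {n : ℕ} [NeZero n]
variable {R : Type*} [Field R] [LinearOrder R] [IsStrictOrderedRing R]

/-- **`(K′)` on the `n`-cycle with the root `a₂` hung on a leaf at `z`**, for every placement of
the five distinct marks `a₁, z, b, v, y` on the cycle and every admissible weight vector with the
leaf weight `≠ 1`. -/
theorem kprime_cycle_rootLeaf_a₂ (p : Fin n ⊕ Unit → R) (hp : IsProbVec p)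
    (he : p (Sum.inr ()) ≠ 1) (a₁ z b v y : Fin n) (h1z : a₁ ≠ z) (h1b : a₁ ≠ b) (h1v : a₁ ≠ v)
    (h1y : a₁ ≠ y) (hzb : z ≠ b) (hzv : z ≠ v) (hzy : z ≠ y) (hbv : b ≠ v) (hby : b ≠ y)
    (hvy : v ≠ y) :
    KPrime.KPrimeHolds (leafExt (cycN n) z) (Sum.inl a₁) (Sum.inr ()) (Sum.inl b) (Sum.inl v)
      (Sum.inl y) p := by
  set w : Fin n → R := p ∘ Sum.inl with hw
  have hwp : IsProbVec w := ⟨fun e => hp.nonneg _, fun e => hp.le_one _⟩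
  -- the arc reduction of the `z`-instance marks
  have hM := card_marks a₁ z b v y h1z h1b h1v h1y hzb hzv hzy hbv hby hvy
  set qe := (marks a₁ z b v y).orderEmbOfFin hM with hqe
  have hq : StrictMono (⇑qe) := qe.strictMono
  obtain ⟨k₁, hk₁⟩ := exists_orderEmb_eq hM (x := a₁) (by simp [marks])
  obtain ⟨kz, hkz⟩ := exists_orderEmb_eq hM (x := z) (by simp [marks])
  obtain ⟨kb, hkb⟩ := exists_orderEmb_eq hM (x := b) (by simp [marks])
  obtain ⟨kv, hkv⟩ := exists_orderEmb_eq hM (x := v) (by simp [marks])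
  obtain ⟨ky, hky⟩ := exists_orderEmb_eq hM (x := y) (by simp [marks])
  rw [← hqe] at hk₁ hkz hkb hkv hky
  set w' : Fin 5 → R := arcProb (⇑qe) w with hw'
  have hw'p : IsProbVec w' := isProbVec_arcProb (⇑qe) hwp
  have hP : ∀ A : Set (Config (Fin 5)), prob w' A = prob w ((fun ω => arcOpen (⇑qe) ω) ⁻¹' A) :=
    fun A => (prob_arcOpen_preimage hq w A).symm
  have hH : ∀ (ω : Config (Fin n)) (x x' : Fin 5),
      Conn (cycN 5) ((fun ω => arcOpen (⇑qe) ω) ω) x x' ↔ Conn (cycN n) ω (qe x) (qe x') :=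
    fun ω x x' => (conn_marks_iff hq ω x x').symm
  have hT := kmasses_transport' hP hH k₁ kz kb kv ky
  have hI := isoMasses_transport' hP hH k₁ kb kv ky
  rw [hk₁, hkz, hkb, hkv, hky] at hT
  rw [hk₁, hkb, hkv, hky] at hI
  have d1z : k₁ ≠ kz := fun h => h1z (by rw [← hk₁, ← hkz, h])
  have d1b : k₁ ≠ kb := fun h => h1b (by rw [← hk₁, ← hkb, h])
  have d1v : k₁ ≠ kv := fun h => h1v (by rw [← hk₁, ← hkv, h])
  have d1y : k₁ ≠ ky := fun h => h1y (by rw [← hk₁, ← hky, h])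
  have dzb : kz ≠ kb := fun h => hzb (by rw [← hkz, ← hkb, h])
  have dzv : kz ≠ kv := fun h => hzv (by rw [← hkz, ← hkv, h])
  have dzy : kz ≠ ky := fun h => hzy (by rw [← hkz, ← hky, h])
  have dbv : kb ≠ kv := fun h => hbv (by rw [← hkb, ← hkv, h])
  have dby : kb ≠ ky := fun h => hby (by rw [← hkb, ← hky, h])
  have dvy : kv ≠ ky := fun h => hvy (by rw [← hkv, ← hky, h])
  set w'' : Fin 5 → R := w' ∘ shiftEquiv k₁ with hw''
  have hw''p : IsProbVec w'' := ⟨fun i => hw'p.nonneg _, fun i => hw'p.le_one _⟩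
  have e0z : (0 : Fin 5) ≠ kz - k₁ := fun h => d1z (sub_eq_zero.1 h.symm).symm
  have e0b : (0 : Fin 5) ≠ kb - k₁ := fun h => d1b (sub_eq_zero.1 h.symm).symm
  have e0v : (0 : Fin 5) ≠ kv - k₁ := fun h => d1v (sub_eq_zero.1 h.symm).symm
  have e0y : (0 : Fin 5) ≠ ky - k₁ := fun h => d1y (sub_eq_zero.1 h.symm).symm
  have ezb : kz - k₁ ≠ kb - k₁ := fun h => dzb (sub_left_injective h)
  have ezv : kz - k₁ ≠ kv - k₁ := fun h => dzv (sub_left_injective h)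
  have ezy : kz - k₁ ≠ ky - k₁ := fun h => dzy (sub_left_injective h)
  have ebv : kb - k₁ ≠ kv - k₁ := fun h => dbv (sub_left_injective h)
  have eby : kb - k₁ ≠ ky - k₁ := fun h => dby (sub_left_injective h)
  have evy : kv - k₁ ≠ ky - k₁ := fun h => dvy (sub_left_injective h)
  refine kprime_leafExt_a₂ (cycN n) z a₁ b v y p hp he ?_ ?_ ?_
    (kprime_cycle w hwp a₁ z b v y h1z h1b h1v h1y hzb hzv hzy hbv hby hvy)
  · rw [← hI, isoMasses_shift5 w' k₁, sub_self]
    exact rootLeafF0_cycle5_zero w'' hw''p _ _ _ _ e0z e0b e0v e0y ezb ezv ezy ebv eby evy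
  · rw [← hI, ← hT, isoMasses_shift5 w' k₁, kmasses_shift5 w' k₁, sub_self]
    exact rootLeafG1_cycle5_zero w'' hw''p _ _ _ _ e0z e0b e0v e0y ezb ezv ezy ebv eby evy
  · rw [← hI, ← hT, isoMasses_shift5 w' k₁, kmasses_shift5 w' k₁, sub_self]
    exact rootLeafG2_cycle5_zero w'' hw''p _ _ _ _ e0z e0b e0v e0y ezb ezv ezy ebv eby evy

end Theorem

end KPrimeCycle

end Summit.Ventures.PercRepro2
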